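import Literature.Analysis.DeBrangesSpaces.BurnolSonineSpaces
import Literature.NumberTheory.LFunctions.MuentzFormulaSchwartz
import Mathlib.Analysis.Distribution.AEEqOfIntegralContDiff
import Mathlib.Analysis.MellinTransform
import HarnessLib

/-!
# Burnol 2001 (CRAS 333), §3: Mellin transforms of the test functions `𝒱_Λ`, the operator
# `D = u (d²/du²) u`, and the completed Mellin transform `M(E(φ)) = Λ(s) φ̂(s)` of a co-Poisson sum
# (PROVED; tools for Théorème 3.1)

LINE 1 — LABEL: RH-FREE (Mellin bookkeeping of smooth functions supported in `[1/Λ, Λ]` and Müntz's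
formula `∫₀^∞ (Σ_{n≥1} φ(nu)) u^{s−1} du = ζ(s) φ̂(s)`; no hypothesis and no conclusion about zeros of
`ζ`). FRAMING (cell rh-crit, D-0074): corpus theorems are RH-FREE literature; nothing here is worded as
progress toward RH. bears_on: B-C/B-P (LADDER-RH COLUMN 6, de Branges framework). WHAT THIS IS NOT:
not a route, not an RH criterion; nothing here bears on the truth of RH.

Source: J.-F. Burnol, *Sur certains espaces de Hilbert de fonctions entières …*, C. R. Acad. Sci. Paris
Sér. I **333** (2001) 201–206 = arXiv:math/0105120 [Burnol2001CRAS], §3 (TeX of record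
`dbl/src/Burnol2001CRAS_arXivmath0105120.tex` l.503–540): "Soit `𝒱_Λ` l'espace vectoriel des fonctions
infiniment différentiables et supportées par `[1/Λ, Λ]`. Soit `D` l'opérateur `u (d²/du²) u` … On notera
que les fonctions de `𝒱_Λ` dans l'image de `D` sont exactement celles vérifiant `φ̂(0) = φ̂(1) = 0` … la
transformée de Mellin complétée est `M(E(φ))(s) = ζ(s) s(s−1) π^{−s/2} Γ(s/2) ψ̂(s)`" (`φ = D(ψ)`).

## What is PROVED (theorem-only module: no definition, no named fact)

* Mellin transforms of `φ ∈ 𝒱_Λ` (`Burnol2001.MemVLambda`): convergence everywhere and entireness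
  (`MemVLambda.mellinConvergent`, `MemVLambda.differentiable_mellin`), `φ̂(0) = ∫₀^∞ φ(t)dt/t`,
  `φ̂(1) = ∫₀^∞ φ` (`MemVLambda.mellin_zero`, `MemVLambda.mellin_one`), so that
  `D(𝒱_Λ) = {φ ∈ 𝒱_Λ : φ̂(0) = φ̂(1) = 0}` reads `memDVLambda_iff_mellin`.
* The first-order operators `T_w θ = −tθ′ − wθ` (so that `D = T_1 T_0` up to the order of factors, and
  `T_w` realises multiplication of the Mellin transform by `s − w`): `MemVLambda.twist`,
  `MemVLambda.mellin_twist` (`(T_w θ)^ = (s − w) θ̂`), the iterates `MemVLambda.twist_iterate`,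
  `MemVLambda.mellin_twist_iterate` (`= (s − w)ⁿ θ̂`), and `memDVLambda_twist_one_twist_zero`
  (`T_1 T_0 ψ ∈ D(𝒱_Λ)` with Mellin transform `s(s−1)ψ̂(s)` — the printed "`φ = D(ψ)`, `φ̂(s) = s(s−1)ψ̂(s)`").
* `exists_memVLambda_mellin_ne_zero` — for `Λ > 1` and every `w` there is `θ ∈ 𝒱_Λ` with `θ̂(w) ≠ 0`
  (fundamental lemma of the calculus of variations on `(1/Λ, Λ)`).
* The completed Mellin transform of `E(φ)`, `φ ∈ D(𝒱_Λ)`: the entire function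
  `M_φ(s) = Λ₀(s) φ̂(s) − φ̂(s)/s + φ̂(s)/(s−1)` (written with `dslope`, `Λ₀ =
  completedRiemannZeta₀`; `= Λ(s)φ̂(s) = π^{−s/2}Γ(s/2)ζ(s)φ̂(s)` off `{0,1}`) —
  `differentiable_completedMellinE`, `completedMellinE_eq_of_ne`, and
  **`isCompletedMellin_poissonE`**: `M_φ(s) = Γ_ℝ(s) · ∫₀^∞ E(φ)(t) t^{s−1} dt` on `Re s > 1/2`
  (Müntz's formula, tree theorem `Literature.NumberTheory.LFunctions.mellin_tsum_schwartz_comp_mul_nat`,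
  plus continuity at `s = 1`), i.e. `Burnol2001.IsCompletedMellin (poissonE φ) M_φ`.

## References
* [Burnol2001CRAS] C. R. Acad. Sci. Paris Sér. I 333 (2001) 201–206, §3 (TeX l.503–540).
* E. C. Titchmarsh, *The Theory of the Riemann Zeta-Function*, §2.11 (Müntz's formula) — tree file
  `MuentzFormulaSchwartz.lean` [Titchmarsh1986].
-/

noncomputable section

open _root_.MeasureTheory _root_.Set _root_.Filter _root_.Complex Asymptotics
open scoped Topology ContDiff
open Literature.NumberTheory.LFunctions

namespace Literature.Analysis.DeBrangesSpaces

namespace Burnol2001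

section TestFunctions

/-! ### Mellin transforms of the test functions `𝒱_Λ` -/

variable {Λ : ℝ} {φ θ : ℝ → ℂ}

/-- `φ ∈ 𝒱_Λ` vanishes off `[1/Λ, Λ]`. [cite: Burnol2001CRAS, §3 (TeX l.503–505)] -/
theorem MemVLambda.eq_zero_of_notMem (hφ : MemVLambda Λ φ) {t : ℝ} (ht : t ∉ Icc Λ⁻¹ Λ) :
    φ t = 0 := by
  by_contra h
  exact ht (hφ.2 (Function.mem_support.2 h))

/-- The closed support of `φ ∈ 𝒱_Λ` lies in `[1/Λ, Λ]`. [cite: Burnol2001CRAS, §3 (TeX l.503–505)] -/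
theorem MemVLambda.tsupport_subset (hφ : MemVLambda Λ φ) : tsupport φ ⊆ Icc Λ⁻¹ Λ :=
  closure_minimal hφ.2 isClosed_Icc

/-- `φ ∈ 𝒱_Λ` has compact support. [cite: Burnol2001CRAS, §3 (TeX l.503–505)] -/
theorem MemVLambda.hasCompactSupport (hφ : MemVLambda Λ φ) : HasCompactSupport φ :=
  HasCompactSupport.of_support_subset_isCompact isCompact_Icc hφ.2

/-- `φ ∈ 𝒱_Λ` is continuous. [cite: Burnol2001CRAS, §3 (TeX l.503–505)] -/
theorem MemVLambda.continuous (hφ : MemVLambda Λ φ) : Continuous φ := hφ.1.continuous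

/-- `φ ∈ 𝒱_Λ` is integrable. [cite: Burnol2001CRAS, §3 (TeX l.503–505)] -/
theorem MemVLambda.integrable (hφ : MemVLambda Λ φ) : Integrable φ :=
  hφ.continuous.integrable_of_hasCompactSupport hφ.hasCompactSupport

/-- `𝒱_Λ` is stable under scalar multiplication by smooth functions: for `Λ > 0`… (elementary; used for
`t ↦ t·θ′(t)`). Here: the zero function is in `𝒱_Λ`. [cite: Burnol2001CRAS, §3 (TeX l.503–505)] -/
theorem memVLambda_zero (Λ : ℝ) : MemVLambda Λ (fun _ : ℝ ↦ (0 : ℂ)) :=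
  ⟨contDiff_const, by simp⟩

/-- For `Λ > 0`, `φ ∈ 𝒱_Λ` vanishes on a neighbourhood of `+∞` and on `(0, 1/Λ)`; hence its Mellin
transform converges at every `s` and is an entire function ("`φ̂` … fonction entière", the transforms
of compactly supported test functions). [cite: Burnol2001CRAS, §3 (TeX l.503–516)] -/
theorem MemVLambda.mellinConvergent_and_differentiableAt (hΛ : 0 < Λ) (hφ : MemVLambda Λ φ) (s : ℂ) :
    MellinConvergent φ s ∧ DifferentiableAt ℂ (mellin φ) s := by
  have hloc : LocallyIntegrableOn φ (Ioi 0) := hφ.continuous.locallyIntegrable.locallyIntegrableOn _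
  have htop : φ =O[atTop] fun x : ℝ ↦ x ^ (-(s.re + 1)) := by
    have : φ =ᶠ[atTop] fun _ ↦ (0 : ℂ) := by
      filter_upwards [eventually_gt_atTop Λ] with t ht
      exact hφ.eq_zero_of_notMem fun h ↦ absurd h.2 (not_le.2 ht)
    exact this.trans_isBigO (isBigO_zero _ _)
  have hbot : φ =O[𝓝[>] (0 : ℝ)] fun x : ℝ ↦ x ^ (-(s.re - 1)) := by
    have : φ =ᶠ[𝓝[>] (0 : ℝ)] fun _ ↦ (0 : ℂ) := by
      have hmem : Iio Λ⁻¹ ∈ 𝓝[>] (0 : ℝ) :=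
        mem_nhdsWithin_of_mem_nhds (Iio_mem_nhds (inv_pos.2 hΛ))
      filter_upwards [hmem] with t ht
      exact hφ.eq_zero_of_notMem fun h ↦ absurd h.1 (not_le.2 ht)
    exact this.trans_isBigO (isBigO_zero _ _)
  exact ⟨mellinConvergent_of_isBigO_rpow hloc htop (by linarith) hbot (by linarith),
    mellin_differentiableAt_of_isBigO_rpow hloc htop (by linarith) hbot (by linarith)⟩

/-- The Mellin transform of `φ ∈ 𝒱_Λ` (`Λ > 0`) converges at every `s`.
[cite: Burnol2001CRAS, §3 (TeX l.503–516)] -/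
theorem MemVLambda.mellinConvergent (hΛ : 0 < Λ) (hφ : MemVLambda Λ φ) (s : ℂ) :
    MellinConvergent φ s :=
  (hφ.mellinConvergent_and_differentiableAt hΛ s).1

/-- The Mellin transform `φ̂` of `φ ∈ 𝒱_Λ` (`Λ > 0`) is entire.
[cite: Burnol2001CRAS, §3 (TeX l.503–516)] -/
theorem MemVLambda.differentiable_mellin (hΛ : 0 < Λ) (hφ : MemVLambda Λ φ) :
    Differentiable ℂ (mellin φ) :=
  fun s ↦ (hφ.mellinConvergent_and_differentiableAt hΛ s).2

/-- `φ̂(0) = ∫₀^∞ φ(t) t⁻¹ dt`. [cite: Burnol2001CRAS, §3 (TeX l.512–516)] -/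
theorem mellin_zero_eq (φ : ℝ → ℂ) : mellin φ 0 = ∫ t in Ioi (0 : ℝ), φ t / (t : ℂ) := by
  rw [mellin]
  refine setIntegral_congr_fun measurableSet_Ioi fun t ht ↦ ?_
  have ht0 : (t : ℂ) ≠ 0 := by exact_mod_cast (ne_of_gt (α := ℝ) ht)
  rw [zero_sub, cpow_neg_one, smul_eq_mul]
  field_simp

/-- `φ̂(1) = ∫₀^∞ φ(t) dt`. [cite: Burnol2001CRAS, §3 (TeX l.512–516)] -/
theorem mellin_one_eq (φ : ℝ → ℂ) : mellin φ 1 = ∫ t in Ioi (0 : ℝ), φ t := by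
  rw [mellin]
  refine setIntegral_congr_fun measurableSet_Ioi fun t _ ↦ ?_
  rw [sub_self, cpow_zero, one_smul]

/-- `D(𝒱_Λ) = {φ ∈ 𝒱_Λ : φ̂(0) = φ̂(1) = 0}` ("les fonctions de `𝒱_Λ` dans l'image de `D` sont exactement
celles vérifiant `φ̂(0) = φ̂(1) = 0`", read through the Mellin transform).
[cite: Burnol2001CRAS, §3 (TeX l.512–516)] -/
theorem memDVLambda_iff_mellin : MemDVLambda Λ φ ↔ MemVLambda Λ φ ∧ mellin φ 0 = 0 ∧ mellin φ 1 = 0 := by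
  rw [MemDVLambda, mellin_zero_eq, mellin_one_eq]

/-! ### The operators `T_w θ = −t θ′ − w θ` (`D = u (d²/du²) u` factors through them) -/

/-- `𝒱_Λ` is stable under `T_w : θ ↦ −tθ′ − wθ` (smooth, same support).
[cite: Burnol2001CRAS, §3 (TeX l.505–516)] -/
theorem MemVLambda.twist (hθ : MemVLambda Λ θ) (w : ℂ) :
    MemVLambda Λ (fun t : ℝ ↦ -((t : ℂ) * deriv θ t) - w * θ t) := by
  have hd : ContDiff ℝ ∞ (deriv θ) := (contDiff_infty_iff_deriv.1 hθ.1).2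
  refine ⟨?_, ?_⟩
  · exact ((ofRealCLM.contDiff.mul hd).neg).sub (contDiff_const.mul hθ.1)
  · intro t ht
    rw [Function.mem_support] at ht
    by_contra hnot
    have h1 : θ t = 0 := by
      by_contra h
      exact hnot (hθ.2 (Function.mem_support.2 h))
    have h2 : deriv θ t = 0 := by
      by_contra h
      exact hnot (hθ.tsupport_subset (support_deriv_subset (Function.mem_support.2 h)))
    exact ht (by rw [h1, h2]; ring)

/-- The iterates `T_wⁿ θ` stay in `𝒱_Λ`. [cite: Burnol2001CRAS, §3 (TeX l.505–516)] -/
theorem MemVLambda.twist_iterate (hθ : MemVLambda Λ θ) (w : ℂ) (n : ℕ) :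
    MemVLambda Λ ((fun (η : ℝ → ℂ) (t : ℝ) ↦ -((t : ℂ) * deriv η t) - w * η t)^[n] θ) := by
  induction n with
  | zero => simpa using hθ
  | succ n ih =>
    rw [Function.iterate_succ_apply']
    exact ih.twist w

/-- **Integration by parts on `(0, ∞)` for a test function**: `∫₀^∞ t^{s−1}·(t θ′(t)) dt = −s θ̂(s)`
for `θ ∈ 𝒱_Λ`, `Λ > 0` (the boundary terms vanish since `θ` has compact support in `(0,∞)`).
[cite: Burnol2001CRAS, §3 (TeX l.512–516)] -/
theorem MemVLambda.mellin_mul_deriv (hΛ : 0 < Λ) (hθ : MemVLambda Λ θ) (s : ℂ) :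
    mellin (fun t : ℝ ↦ (t : ℂ) * deriv θ t) s = -(s * mellin θ s) := by
  -- work on the interval `[a, b] = [Λ⁻¹/2, Λ + 1] ⊃ [1/Λ, Λ] ⊇ supp θ`, with `a > 0`
  set a : ℝ := Λ⁻¹ / 2 with ha_def
  set b : ℝ := Λ⁻¹ + Λ + 1 with hb_def
  have ha : 0 < a := by positivity
  have hab : a ≤ b := by
    rw [ha_def, hb_def]; linarith [inv_pos.2 hΛ]
  have hθd : Differentiable ℝ θ := (contDiff_infty_iff_deriv.1 hθ.1).1
  have hdc : Continuous (deriv θ) := (contDiff_infty_iff_deriv.1 hθ.1).2.continuous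
  -- outside `[1/Λ, Λ]`, `θ` and `θ'` vanish
  have hθ0 : ∀ t, t ∉ Icc Λ⁻¹ Λ → θ t = 0 := fun t ht ↦ hθ.eq_zero_of_notMem ht
  have hθ'0 : ∀ t, t ∉ Icc Λ⁻¹ Λ → deriv θ t = 0 := by
    intro t ht
    by_contra h
    exact ht (hθ.tsupport_subset (support_deriv_subset (Function.mem_support.2 h)))
  have haI : a ∉ Icc Λ⁻¹ Λ := fun h ↦ by
    have := h.1; rw [ha_def] at this; linarith [inv_pos.2 hΛ]
  have hbI : b ∉ Icc Λ⁻¹ Λ := fun h ↦ by have := h.2; rw [hb_def] at this; linarith [inv_pos.2 hΛ]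
  -- the primitive `G(t) = t^s θ(t)` and its derivative on `t > 0`
  have hderiv : ∀ t : ℝ, 0 < t → HasDerivAt (fun u : ℝ ↦ (u : ℂ) ^ s * θ u)
      (s * (t : ℂ) ^ (s - 1) * θ t + (t : ℂ) ^ s * deriv θ t) t := by
    intro t ht
    have h1 : HasDerivAt (fun u : ℝ ↦ (u : ℂ) ^ s) (s * (t : ℂ) ^ (s - 1)) t := by
      have hc : HasDerivAt (fun z : ℂ ↦ z ^ s) (s * (t : ℂ) ^ (s - 1)) (t : ℂ) :=
        (Complex.hasStrictDerivAt_cpow_const (c := s) (Complex.ofReal_mem_slitPlane.2 ht)).hasDerivAt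
      exact hc.comp_ofReal
    have h2 : HasDerivAt θ (deriv θ t) t := (hθd t).hasDerivAt
    have h2' : HasDerivAt (fun u : ℝ ↦ θ u) (deriv θ t) t := h2
    exact h1.mul h2'
  -- `∫_a^b G' = G b - G a = 0`
  have hint : IntervalIntegrable (fun t : ℝ ↦ s * (t : ℂ) ^ (s - 1) * θ t + (t : ℂ) ^ s * deriv θ t)
      volume a b := by
    refine ContinuousOn.intervalIntegrable ?_
    rw [uIcc_of_le hab]
    have hcpow : ∀ c : ℂ, ContinuousOn (fun t : ℝ ↦ (t : ℂ) ^ c) (Icc a b) := by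
      intro c
      refine ContinuousOn.mono ?_ (show Icc a b ⊆ Ioi 0 from fun t ht ↦ ha.trans_le ht.1)
      intro t ht
      exact (continuousAt_ofReal_cpow_const t c (Or.inr (ne_of_gt ht))).continuousWithinAt
    exact ((continuousOn_const.mul (hcpow _)).mul hθ.continuous.continuousOn).add
      ((hcpow _).mul hdc.continuousOn)
  have hFTC := intervalIntegral.integral_eq_sub_of_hasDerivAt
    (f := fun u : ℝ ↦ (u : ℂ) ^ s * θ u)
    (fun t ht ↦ hderiv t (ha.trans_le (by rw [uIcc_of_le hab] at ht; exact ht.1))) hint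
  rw [hθ0 a haI, hθ0 b hbI, mul_zero, mul_zero, sub_zero] at hFTC
  -- rewrite the two Mellin integrals as integrals over `(a, b]`
  have hIoc : Ioc a b ⊆ Ioi (0 : ℝ) := fun t ht ↦ ha.trans ht.1
  have hvanish : ∀ (g : ℝ → ℂ), (∀ t, t ∉ Icc Λ⁻¹ Λ → g t = 0) →
      ∀ c : ℂ, ∫ t in Ioi (0 : ℝ), (t : ℂ) ^ c * g t = ∫ t in Ioc a b, (t : ℂ) ^ c * g t := by
    intro g hg c
    refine setIntegral_eq_of_subset_of_forall_sdiff_eq_zero measurableSet_Ioi hIoc fun t ht ↦ ?_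
    have : t ∉ Icc Λ⁻¹ Λ := by
      intro h
      apply ht.2
      refine ⟨?_, ?_⟩
      · have := h.1; rw [ha_def]; linarith [inv_pos.2 hΛ]
      · have := h.2; rw [hb_def]; linarith [inv_pos.2 hΛ]
    rw [hg t this, mul_zero]
  have hm1 : mellin (fun t : ℝ ↦ (t : ℂ) * deriv θ t) s = ∫ t in Ioc a b, (t : ℂ) ^ s * deriv θ t := by
    rw [mellin, ← hvanish (deriv θ) hθ'0 s]
    refine setIntegral_congr_fun measurableSet_Ioi fun t ht ↦ ?_
    have ht0 : (t : ℂ) ≠ 0 := by exact_mod_cast (ne_of_gt (α := ℝ) ht)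
    have hts : (t : ℂ) ^ s = (t : ℂ) ^ (s - 1) * t := by
      conv_lhs => rw [show s = (s - 1) + 1 by ring, cpow_add _ _ ht0, cpow_one]
    rw [smul_eq_mul, hts]
    ring
  have hm2 : mellin θ s = ∫ t in Ioc a b, (t : ℂ) ^ (s - 1) * θ t := by
    rw [mellin, ← hvanish θ hθ0 (s - 1)]
    rfl
  -- split `∫_a^b G'` into the two pieces
  have hi1 : IntegrableOn (fun t : ℝ ↦ s * (t : ℂ) ^ (s - 1) * θ t) (Ioc a b) := by
    have hc : ContinuousOn (fun t : ℝ ↦ s * (t : ℂ) ^ (s - 1) * θ t) (Icc a b) := by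
      refine (continuousOn_const.mul ?_).mul hθ.continuous.continuousOn
      intro t ht
      exact (continuousAt_ofReal_cpow_const t _ (Or.inr (ne_of_gt (ha.trans_le ht.1)))).continuousWithinAt
    exact (hc.integrableOn_compact isCompact_Icc).mono_set Ioc_subset_Icc_self
  have hi2 : IntegrableOn (fun t : ℝ ↦ (t : ℂ) ^ s * deriv θ t) (Ioc a b) := by
    have hc : ContinuousOn (fun t : ℝ ↦ (t : ℂ) ^ s * deriv θ t) (Icc a b) := by
      refine ContinuousOn.mul ?_ hdc.continuousOn
      intro t ht
      exact (continuousAt_ofReal_cpow_const t _ (Or.inr (ne_of_gt (ha.trans_le ht.1)))).continuousWithinAt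
    exact (hc.integrableOn_compact isCompact_Icc).mono_set Ioc_subset_Icc_self
  rw [intervalIntegral.integral_of_le hab, integral_add hi1 hi2] at hFTC
  have hsm : ∫ t in Ioc a b, s * (t : ℂ) ^ (s - 1) * θ t = s * mellin θ s := by
    rw [hm2, ← integral_const_mul]
    refine setIntegral_congr_fun measurableSet_Ioc fun t _ ↦ ?_
    ring
  rw [hm1]
  rw [hsm] at hFTC
  linear_combination hFTC

/-- **`(T_w θ)^(s) = (s − w) θ̂(s)`**: the operator `θ ↦ −tθ′ − wθ` multiplies the Mellin transform by
`s − w` (for `D = u(d²/du²)u = T_1 T_0` this is the printed `(Dψ)^(s) = s(s−1)ψ̂(s)`).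
[cite: Burnol2001CRAS, §3 (TeX l.512–516, 536–540)] -/
theorem MemVLambda.mellin_twist (hΛ : 0 < Λ) (hθ : MemVLambda Λ θ) (w s : ℂ) :
    mellin (fun t : ℝ ↦ -((t : ℂ) * deriv θ t) - w * θ t) s = (s - w) * mellin θ s := by
  -- `t θ'` is again a test function (it is `-(T_0 θ)`), so its Mellin integrand is integrable
  have h1 : IntegrableOn (fun t : ℝ ↦ (t : ℂ) ^ (s - 1) • ((t : ℂ) * deriv θ t)) (Ioi 0) := by
    have h := (hθ.twist 0).mellinConvergent hΛ s
    rw [MellinConvergent] at h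
    refine (h.neg).congr_fun (fun t _ ↦ ?_) measurableSet_Ioi
    simp only [Pi.neg_apply, zero_mul, sub_zero, smul_neg, neg_neg]
  have h2 : IntegrableOn (fun t : ℝ ↦ (t : ℂ) ^ (s - 1) • θ t) (Ioi 0) := hθ.mellinConvergent hΛ s
  have hderiv := hθ.mellin_mul_deriv hΛ s
  rw [mellin] at hderiv
  have hsplit : ∀ t ∈ Ioi (0 : ℝ), (t : ℂ) ^ (s - 1) • (-((t : ℂ) * deriv θ t) - w * θ t) =
      -((t : ℂ) ^ (s - 1) • ((t : ℂ) * deriv θ t)) - w * ((t : ℂ) ^ (s - 1) • θ t) := by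
    intro t _
    simp only [smul_eq_mul]
    ring
  have h1' : Integrable (fun t : ℝ ↦ -((t : ℂ) ^ (s - 1) • ((t : ℂ) * deriv θ t)))
      (volume.restrict (Ioi 0)) := h1.neg
  have h2' : Integrable (fun t : ℝ ↦ w * ((t : ℂ) ^ (s - 1) • θ t)) (volume.restrict (Ioi 0)) :=
    h2.const_mul w
  rw [mellin, setIntegral_congr_fun measurableSet_Ioi hsplit, integral_sub h1' h2', integral_neg,
    integral_const_mul, hderiv, mellin]
  ring

/-- `(T_wⁿ θ)^(s) = (s − w)ⁿ θ̂(s)`. [cite: Burnol2001CRAS, §3 (TeX l.512–516, 536–540)] -/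
theorem MemVLambda.mellin_twist_iterate (hΛ : 0 < Λ) (hθ : MemVLambda Λ θ) (w : ℂ) (n : ℕ) (s : ℂ) :
    mellin ((fun (η : ℝ → ℂ) (t : ℝ) ↦ -((t : ℂ) * deriv η t) - w * η t)^[n] θ) s =
      (s - w) ^ n * mellin θ s := by
  induction n with
  | zero => simp
  | succ n ih =>
    rw [Function.iterate_succ_apply', (hθ.twist_iterate w n).mellin_twist hΛ, ih]
    ring

/-- **`φ = T_1 T_0 ψ` lies in `D(𝒱_Λ)`** with `φ̂(s) = s(s−1) ψ̂(s)` (the printed `φ = D(ψ)`,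
`φ̂(s) = s(s−1)ψ̂(s)`, so `φ̂(0) = φ̂(1) = 0`). [cite: Burnol2001CRAS, §3 (TeX l.512–516, 536–540)] -/
theorem memDVLambda_twist_one_twist_zero (hΛ : 0 < Λ) {ψ : ℝ → ℂ} (hψ : MemVLambda Λ ψ) :
    MemDVLambda Λ (fun t : ℝ ↦ -((t : ℂ) * deriv (fun u : ℝ ↦ -((u : ℂ) * deriv ψ u) - 0 * ψ u) t) -
      1 * (fun u : ℝ ↦ -((u : ℂ) * deriv ψ u) - 0 * ψ u) t) ∧
    ∀ s : ℂ, mellin (fun t : ℝ ↦ -((t : ℂ) * deriv (fun u : ℝ ↦ -((u : ℂ) * deriv ψ u) - 0 * ψ u) t) -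
      1 * (fun u : ℝ ↦ -((u : ℂ) * deriv ψ u) - 0 * ψ u) t) s = s * (s - 1) * mellin ψ s := by
  have h0 : MemVLambda Λ (fun u : ℝ ↦ -((u : ℂ) * deriv ψ u) - 0 * ψ u) := hψ.twist 0
  have h1 := h0.twist 1
  have hm : ∀ s : ℂ, mellin (fun t : ℝ ↦ -((t : ℂ) * deriv (fun u : ℝ ↦ -((u : ℂ) * deriv ψ u) -
      0 * ψ u) t) - 1 * (fun u : ℝ ↦ -((u : ℂ) * deriv ψ u) - 0 * ψ u) t) s =
      s * (s - 1) * mellin ψ s := by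
    intro s
    rw [h0.mellin_twist hΛ 1 s, hψ.mellin_twist hΛ 0 s]
    ring
  refine ⟨memDVLambda_iff_mellin.2 ⟨h1, ?_, ?_⟩, hm⟩
  · rw [hm 0]; ring
  · rw [hm 1]; ring

/-! ### A test function with `θ̂(w) ≠ 0` -/

/-- A real smooth function compactly supported in `(1/Λ, Λ)`, viewed in `ℂ`, is in `𝒱_Λ`.
[cite: Burnol2001CRAS, §3 (TeX l.503–505)] -/
theorem memVLambda_ofReal_of_tsupport_subset {g : ℝ → ℝ} (hg : ContDiff ℝ ∞ g)
    (hsupp : tsupport g ⊆ Ioo Λ⁻¹ Λ) : MemVLambda Λ (fun t : ℝ ↦ (g t : ℂ)) := by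
  refine ⟨ofRealCLM.contDiff.comp hg, ?_⟩
  intro t ht
  have ht' : t ∈ Function.support g := by
    rw [Function.mem_support] at ht ⊢
    intro h; exact ht (by rw [h]; simp)
  exact Ioo_subset_Icc_self (hsupp (subset_tsupport _ ht'))

/-- **For `Λ > 1` and every `w ∈ ℂ` some `θ ∈ 𝒱_Λ` has `θ̂(w) ≠ 0`**: otherwise `∫ g(t) t^{w−1} dt = 0` for
every smooth `g` supported in `(1/Λ, Λ)`, so `t^{w−1} = 0` a.e. there (fundamental lemma of the
calculus of variations), which is absurd since the interval is non-empty.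
[cite: Burnol2001CRAS, §3 (TeX l.536–540: "`ψ ∈ 𝒱_Λ` est arbitraire")] -/
theorem exists_memVLambda_mellin_ne_zero (hΛ : 1 < Λ) (w : ℂ) :
    ∃ θ : ℝ → ℂ, MemVLambda Λ θ ∧ mellin θ w ≠ 0 := by
  have hΛ0 : 0 < Λ := zero_lt_one.trans hΛ
  have hlt : Λ⁻¹ < Λ := (inv_lt_one_of_one_lt₀ hΛ).trans hΛ
  by_contra hall
  push Not at hall
  set U : Set ℝ := Ioo Λ⁻¹ Λ with hU_def
  have hU : IsOpen U := isOpen_Ioo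
  have hUpos : U ⊆ Ioi 0 := fun t ht ↦ (inv_pos.2 hΛ0).trans ht.1
  set f : ℝ → ℂ := fun t ↦ (t : ℂ) ^ (w - 1) with hf_def
  have hfc : ContinuousOn f (Ioi 0) := fun t ht ↦
    (continuousAt_ofReal_cpow_const t _ (Or.inr (ne_of_gt ht))).continuousWithinAt
  have hfl : LocallyIntegrableOn f U volume :=
    (hfc.mono hUpos).locallyIntegrableOn measurableSet_Ioo
  have key : ∀ᵐ x : ℝ, x ∈ U → f x = 0 := by
    refine hU.ae_eq_zero_of_integral_contDiff_smul_eq_zero hfl fun g hg hgs hgU ↦ ?_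
    have hθ : MemVLambda Λ (fun t : ℝ ↦ (g t : ℂ)) := memVLambda_ofReal_of_tsupport_subset hg hgU
    have hm := hall _ hθ
    rw [mellin] at hm
    have hzero : ∀ x, x ∉ Ioi (0 : ℝ) → g x • f x = 0 := by
      intro x hx
      have : g x = 0 := by
        by_contra h
        exact hx (hUpos (hgU (subset_tsupport _ (Function.mem_support.2 h))))
      rw [this, zero_smul]
    rw [← setIntegral_eq_integral_of_forall_compl_eq_zero hzero, ← hm]
    refine setIntegral_congr_fun measurableSet_Ioi fun t _ ↦ ?_
    rw [hf_def, smul_eq_mul, Complex.real_smul, mul_comm]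
  -- but `f ≠ 0` on `U`, a set of positive measure
  have hnot : ∀ᵐ x : ℝ, x ∉ U := by
    filter_upwards [key] with x hx hxU
    have hx0 : (x : ℂ) ≠ 0 := by exact_mod_cast (ne_of_gt ((inv_pos.2 hΛ0).trans hxU.1))
    have hne : f x ≠ 0 := fun h ↦ hx0 ((cpow_eq_zero_iff _ _).1 h).1
    exact hne (hx hxU)
  have hnull : volume U = 0 := measure_eq_zero_iff_ae_notMem.2 hnot
  rw [hU_def, Real.volume_Ioo, ENNReal.ofReal_eq_zero] at hnull
  linarith

end TestFunctions

section CompletedMellin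

/-! ### The completed Mellin transform `M(E(φ)) = Λ(s) φ̂(s)` of a co-Poisson sum -/

variable {Λ : ℝ} {φ : ℝ → ℂ}

open Literature.NumberTheory.Automorphic.Meyer (mellinConvergent_schwartz)

/-- `dslope` of an entire function is entire (power series at the base point, difference quotient
elsewhere). [folklore] -/
private theorem differentiable_dslope {f : ℂ → ℂ} (hf : Differentiable ℂ f) (a : ℂ) :
    Differentiable ℂ (dslope f a) := by
  intro z
  by_cases hz : z = a
  · subst hz
    obtain ⟨p, hp⟩ := hf.analyticAt z
    exact hp.has_fpower_series_dslope_fslope.analyticAt.differentiableAt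
  · exact (differentiableAt_dslope_of_ne hz).2 (hf z)

/-- **The completed Mellin transform of `E(φ)` is entire**: for `φ ∈ 𝒱_Λ` (`Λ > 0`) the function
`M_φ(s) = Λ₀(s)φ̂(s) − (φ̂(s) − φ̂(0))/s + (φ̂(s) − φ̂(1))/(s−1)` (written with `dslope`; for
`φ ∈ D(𝒱_Λ)` the two corrections are `φ̂(s)/s` and `φ̂(s)/(s−1)`) is entire ("la fonction entière
`M(f)(s)`", TeX l.437–440; for `f = E(φ)`: TeX l.536–540).
[cite: Burnol2001CRAS, §2–3 (TeX l.437–440, 536–540)] -/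
theorem differentiable_completedMellinE (hΛ : 0 < Λ) (hφ : MemVLambda Λ φ) :
    Differentiable ℂ (fun s : ℂ ↦ completedRiemannZeta₀ s * mellin φ s - dslope (mellin φ) 0 s +
      dslope (mellin φ) 1 s) := by
  have hm : Differentiable ℂ (mellin φ) := hφ.differentiable_mellin hΛ
  exact ((differentiable_completedZeta₀.mul hm).sub (differentiable_dslope hm 0)).add
    (differentiable_dslope hm 1)

/-- Off `{0, 1}` and for `φ̂(0) = φ̂(1) = 0`, `M_φ(s) = Λ(s) φ̂(s)` with `Λ = completedRiemannZeta`
(`= π^{−s/2}Γ(s/2)ζ(s)`). [cite: Burnol2001CRAS, §3 (TeX l.536–540)] -/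
theorem completedMellinE_eq_of_ne (h0 : mellin φ 0 = 0) (h1 : mellin φ 1 = 0) {s : ℂ}
    (hs0 : s ≠ 0) (hs1 : s ≠ 1) :
    completedRiemannZeta₀ s * mellin φ s - dslope (mellin φ) 0 s + dslope (mellin φ) 1 s =
      completedRiemannZeta s * mellin φ s := by
  rw [dslope_of_ne _ hs0, dslope_of_ne _ hs1, slope_def_module, slope_def_module, h0, h1,
    completedRiemannZeta_eq]
  have hs1' : s - 1 ≠ 0 := sub_ne_zero.2 hs1
  have hs1'' : (1 : ℂ) - s ≠ 0 := sub_ne_zero.2 (Ne.symm hs1)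
  simp only [sub_zero, smul_eq_mul]
  field_simp
  ring

/-- **Müntz's formula for `E(φ)`**, `φ ∈ D(𝒱_Λ)`: for `Re s > 0`, `s ≠ 1`, the Mellin transform of
`E(φ)(u) = Σ_{n≥1} φ(nu)` (recall `∫₀^∞ φ = 0`) converges and equals `ζ(s) φ̂(s)` (tree theorem
`mellin_tsum_schwartz_comp_mul_nat`, Titchmarsh §2.11). [cite: Burnol2001CRAS, §3 (TeX l.536–540)] -/
theorem mellin_poissonE_eq (hφ : MemDVLambda Λ φ) {s : ℂ} (hs : 0 < s.re) (hs1 : s ≠ 1) :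
    MellinConvergent (poissonE φ) s ∧ mellin (poissonE φ) s = riemannZeta s * mellin φ s := by
  obtain ⟨hV, _, h1⟩ := hφ
  set F : SchwartzMap ℝ ℂ := hV.hasCompactSupport.toSchwartzMap hV.1 with hF_def
  have hF : ∀ x, F x = φ x := fun x ↦ rfl
  have hint : ∫ t in Ioi (0 : ℝ), F t = 0 := h1
  obtain ⟨hconv, heq⟩ := mellin_tsum_schwartz_comp_mul_nat F hint hs hs1
  have hEq : EqOn (fun x : ℝ ↦ ∑' n : ℕ, F (((n + 1 : ℕ) : ℝ) * x)) (poissonE φ) (Ioi 0) := by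
    intro x hx
    have hx' : (0 : ℝ) < x := hx
    simp only [poissonE, h1, zero_div, sub_zero, abs_of_pos hx', hF]
    refine tsum_congr fun n ↦ ?_
    push_cast
    ring_nf
  refine ⟨?_, ?_⟩
  · rw [MellinConvergent] at hconv ⊢
    exact hconv.congr_fun (fun t ht ↦ by simp only [hEq ht]) measurableSet_Ioi
  · have hmF : mellin (fun x : ℝ ↦ F x) s = mellin φ s := rfl
    rw [← hmF, ← heq]
    exact setIntegral_congr_fun measurableSet_Ioi fun t ht ↦ by simp only [hEq ht]

/-- The Mellin transform of `E(φ)`, `φ ∈ D(𝒱_Λ)`, is holomorphic on `0 < Re s < 2` (in particular at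
`s = 1`): `E(φ)` is bounded near `0` (Riemann-sum estimate) and vanishes near `∞`.
[cite: Burnol2001CRAS, §3 (TeX l.528–540)] -/
theorem differentiableAt_mellin_poissonE (hφ : MemDVLambda Λ φ) {s : ℂ} (hs : 0 < s.re)
    (hs2 : s.re < 2) : DifferentiableAt ℂ (mellin (poissonE φ)) s := by
  obtain ⟨hV, _, h1⟩ := hφ
  set F : SchwartzMap ℝ ℂ := hV.hasCompactSupport.toSchwartzMap hV.1 with hF_def
  have hF : ∀ x, F x = φ x := fun x ↦ rfl
  have hint : ∫ t in Ioi (0 : ℝ), F t = 0 := h1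
  have hEq : EqOn (fun x : ℝ ↦ ∑' n : ℕ, F (((n + 1 : ℕ) : ℝ) * x)) (poissonE φ) (Ioi 0) := by
    intro x hx
    have hx' : (0 : ℝ) < x := hx
    simp only [poissonE, h1, zero_div, sub_zero, abs_of_pos hx', hF]
    refine tsum_congr fun n ↦ ?_
    push_cast
    ring_nf
  have hG_int : LocallyIntegrableOn (fun x : ℝ ↦ ∑' n : ℕ, F (((n + 1 : ℕ) : ℝ) * x)) (Ioi 0) :=
    locallyIntegrableOn_tsum_comp_mul_nat (fun x : ℝ ↦ F x) (s := 2) (by norm_num)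
      (mellinConvergent_schwartz F (by norm_num))
  have hG_top := isBigO_atTop_tsum_schwartz_comp_mul_nat F (k := 2) le_rfl
  have hG_bot := isBigO_nhdsGT_tsum_schwartz_comp_mul_nat F hint
  have hdiff : DifferentiableAt ℂ (mellin (fun x : ℝ ↦ ∑' n : ℕ, F (((n + 1 : ℕ) : ℝ) * x))) s :=
    mellin_differentiableAt_of_isBigO_rpow hG_int hG_top (by exact_mod_cast hs2) hG_bot
      (by simpa using hs)
  have hfun : mellin (fun x : ℝ ↦ ∑' n : ℕ, F (((n + 1 : ℕ) : ℝ) * x)) = mellin (poissonE φ) := by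
    funext z
    exact setIntegral_congr_fun measurableSet_Ioi fun t ht ↦ by simp only [hEq ht]
  rwa [hfun] at hdiff

/-- `E(φ)` a.e. equal functions have the same Mellin transform (the transform is an integral over
`(0,∞)`), so `IsCompletedMellin` passes to a.e.-equal representatives — used for the `L²` class of `E(φ)`.
[cite: Burnol2001CRAS, §2 (TeX l.437–441)] -/
theorem IsCompletedMellin.congr_ae {f g : ℝ → ℂ} {M : ℂ → ℂ} (h : IsCompletedMellin f M)
    (hfg : ∀ᵐ t : ℝ, g t = f t) : IsCompletedMellin g M := by
  refine ⟨h.1, fun s hs ↦ ?_⟩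
  rw [h.2 s hs, mellin, mellin]
  congr 1
  refine integral_congr_ae ?_
  filter_upwards [ae_restrict_of_ae (s := Ioi (0 : ℝ)) hfg] with t ht
  rw [ht]

/-- **`M_φ` IS the completed Mellin transform of `E(φ)`** for `φ ∈ D(𝒱_Λ)`, `Λ > 0`:
`M_φ(s) = π^{−s/2}Γ(s/2) ∫₀^∞ E(φ)(t) t^{s−1} dt` for `Re s > 1/2` — Müntz's formula `(E φ)^(s) = ζ(s)φ̂(s)`
on `Re s > 0`, `s ≠ 1`, the identity `Γ_ℝ(s)ζ(s) = Λ(s)`, and continuity of both sides at `s = 1`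
("la transformée de Mellin complétée est `M(E(φ))(s) = ζ(s)s(s−1)π^{−s/2}Γ(s/2)ψ̂(s)`", for `φ = Dψ`).
[cite: Burnol2001CRAS, §3 (TeX l.536–540)] -/
theorem isCompletedMellin_poissonE (hΛ : 0 < Λ) (hφ : MemDVLambda Λ φ) :
    IsCompletedMellin (poissonE φ) (fun s : ℂ ↦ completedRiemannZeta₀ s * mellin φ s -
      dslope (mellin φ) 0 s + dslope (mellin φ) 1 s) := by
  have hφ' := hφ
  obtain ⟨hV, h0, h1⟩ := memDVLambda_iff_mellin.1 hφ
  refine ⟨differentiable_completedMellinE hΛ hV, fun s hs ↦ ?_⟩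
  -- the identity off `s = 1`
  have key : ∀ z : ℂ, 1 / 2 < z.re → z ≠ 1 →
      completedRiemannZeta₀ z * mellin φ z - dslope (mellin φ) 0 z + dslope (mellin φ) 1 z =
        Gammaℝ z * mellin (poissonE φ) z := by
    intro z hz hz1
    have hz0 : z ≠ 0 := by
      rintro rfl
      norm_num at hz
    have hzre : 0 < z.re := by linarith
    rw [completedMellinE_eq_of_ne h0 h1 hz0 hz1, (mellin_poissonE_eq hφ' hzre hz1).2, ← mul_assoc,
      riemannZeta_def_of_ne_zero hz0, mul_div_cancel₀ _ (Gammaℝ_ne_zero_of_re_pos hzre)]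
  by_cases hs1 : s = 1
  · -- continuity at `s = 1`
    subst hs1
    have hcl : ContinuousAt (fun z : ℂ ↦ completedRiemannZeta₀ z * mellin φ z - dslope (mellin φ) 0 z +
        dslope (mellin φ) 1 z) 1 := (differentiable_completedMellinE hΛ hV 1).continuousAt
    have hcr : ContinuousAt (fun z : ℂ ↦ Gammaℝ z * mellin (poissonE φ) z) 1 := by
      have hG : DifferentiableAt ℂ Gammaℝ 1 := by
        have h := (differentiable_Gammaℝ_inv (1 : ℂ)).inv
          (inv_ne_zero (Gammaℝ_ne_zero_of_re_pos (by simp)))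
        have e' : (fun z : ℂ ↦ (Gammaℝ z)⁻¹)⁻¹ = Gammaℝ := by funext z; simp
        rw [e'] at h
        exact h
      exact (hG.mul (differentiableAt_mellin_poissonE hφ' (by simp) (by norm_num))).continuousAt
    have hev : (fun z : ℂ ↦ completedRiemannZeta₀ z * mellin φ z - dslope (mellin φ) 0 z +
        dslope (mellin φ) 1 z) =ᶠ[𝓝[≠] (1 : ℂ)] fun z ↦ Gammaℝ z * mellin (poissonE φ) z := by
      have hopen : {z : ℂ | 1 / 2 < z.re} ∈ 𝓝 (1 : ℂ) :=
        (isOpen_lt continuous_const Complex.continuous_re).mem_nhds (by simp; norm_num)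
      filter_upwards [mem_nhdsWithin_of_mem_nhds hopen, self_mem_nhdsWithin] with z hz hz1
      exact key z hz hz1
    have hl := (hcl.tendsto.mono_left nhdsWithin_le_nhds).congr' hev
    exact tendsto_nhds_unique hl (hcr.tendsto.mono_left nhdsWithin_le_nhds)
  · exact key s hs hs1

end CompletedMellin

end Burnol2001

end Literature.Analysis.DeBrangesSpaces
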